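import Summits.Parity.GeneralizedHardyLittlewood.Theorems.RomanoffHeathBrownClassEnergyTools

/-!
# Route `RomanoffHeathBrown` — crux `SmallModuliCorrelation` (stmt-Parity-20272), PROVED

`theorem romanoffHeathBrown_smallModuliCorrelation_proof : SmallModuliCorrelation`: for every `c > 0`
there are `C, N₀` with
`∑_{d ≤ √(ηX), d odd squarefree} g(d) ∑_{r<d} U_d(r)² ≤ C · η²N · U` for `N ≥ N₀`
(`u = hbWeight c N`, `U = ∑_{k≤N} u(k)`, `U_d(r) = ∑_{k ≤ N, k ≡ r (d)} u(k)`, `g(d) = ∏_{p∣d} 1/(p−2)`,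
`X = (N/6)^{1/3}`, `η = (log X)^{−c}`).

Proof (the route's BC3 skeleton): (A) `classSum_le_small` — for odd square-free `d ≤ √(ηX)` every
class sum is `≤ C₁ 6^{ω(d)}/d · η²N`: the tree's class Brun–Titchmarsh bound
`CubicMinorant.sum_hbWeight_modEq_le` with `ν_d(r) cw(d) ≤ 6^{ω(d)} d`
(`cubicClassCount_prod_primes_le`, `coprimeClassWeight_le_two_pow`), the threshold `S/d ≥ √(ηX) − 1`
and the log saving `log(S/d) ≥ (3/16) log X ≥ (3/64) log N` (from `√X ≤ ηX`, `S ≥ ηX − 1`), while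
non-coprime classes are empty (`sum_hbWeight_modEq_eq_zero_of_not_coprime`); (B) `eulerSum_six_le` —
`∑_{d odd sqf} g(d) 6^{ω(d)}/d ≤ ∏_p (1 + 18/p²) ≤ exp(∑ 18/n²)`; (C) `∑_r U_d(r)² ≤ sup_r U_d(r) · U`
(`classEnergy_le`).

References: Heath-Brown–Moroz, Proc. LMS 88 (2004) §3 [HeathBrownMoroz2004]; Halberstam–Richert,
*Sieve Methods* Thm 3.6 [HalberstamRichert1974]; Nathanson (1996) §7.6 [Nathanson1996].
-/

noncomputable section

open Finset Filter Topology
open Literature.NumberTheory.Sieve Literature.NumberTheory.Sieve.CubicPrimes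
open Literature.NumberTheory.Sieve.CubicMinorant
open Summit.Parity.GeneralizedHardyLittlewood.Theses.RomanoffHeathBrown

namespace Summit.Parity.GeneralizedHardyLittlewood.Theorems.RomanoffHeathBrown

/-! ### (A) the per-class sup bound on the small moduli -/

/-- The arithmetic of step (A): `C·(A ℓN)·ν·cw·(S/d)²/ℓq ≤ (128/3)C · ω₆/d · η²(6X³)` from
`A ≤ 2X`, `ν cw ≤ ω₆ d`, `S ≤ 2ηX`, `ℓN ≤ 32 ℓq`. [this line] -/
theorem classSup_arith {C A ℓN ν cw S d ℓq X η ω₆ : ℝ} (hC : 0 ≤ C)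
    (hA : A ≤ 2 * X) (hX : 0 ≤ X) (hν : 0 ≤ ν) (hcw : 0 ≤ cw) (hω : 0 ≤ ω₆) (hνcw : ν * cw ≤ ω₆ * d)
    (hd : 0 < d) (hS0 : 0 ≤ S) (hS : S ≤ 2 * (η * X)) (hℓq : 0 < ℓq) (hℓN0 : 0 ≤ ℓN)
    (hℓN : ℓN ≤ 32 * ℓq) :
    C * (A * ℓN) * ν * cw * (S / d) ^ 2 / ℓq ≤ 128 / 3 * C * (ω₆ / d) * (η ^ 2 * (6 * X ^ 3)) := by
  have h2 : ℓN / ℓq ≤ 32 := (div_le_iff₀ hℓq).mpr (by linarith)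
  have hηX : 0 ≤ η * X := by linarith
  calc C * (A * ℓN) * ν * cw * (S / d) ^ 2 / ℓq
      = C * A * (ν * cw) * (S ^ 2 / d ^ 2) * (ℓN / ℓq) := by rw [div_pow]; ring
    _ ≤ C * (2 * X) * (ω₆ * d) * ((2 * (η * X)) ^ 2 / d ^ 2) * 32 := by gcongr
    _ = 128 / 3 * C * (ω₆ / d) * (η ^ 2 * (6 * X ^ 3)) := by field_simp; ring

/-- **(A) Class Brun–Titchmarsh on the small moduli**: for every `c > 0` there are `C₁ ≥ 0` and `N₀`
such that for `N ≥ N₀`, every odd square-free `1 ≤ d ≤ √(ηX)` and every `r`,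
`U_d(r) ≤ C₁ · 6^{ω(d)}/d · η²N`.
[cite: HeathBrownMoroz2004, §3 (3.1)–(3.3) (Brun–Titchmarsh for the form in residue classes)] -/
theorem classSum_le_small {c : ℝ} (hc : 0 < c) :
    ∃ C₁ : ℝ, 0 ≤ C₁ ∧ ∃ N₀ : ℕ, ∀ N : ℕ, N₀ ≤ N → ∀ d : ℕ, Squarefree d → Odd d → 1 ≤ d →
      (d : ℝ) ≤ Real.sqrt (hbEta c N * hbX N) → ∀ r : ℕ,
        ∑ k ∈ (Icc 1 N).filter (fun k : ℕ => k ≡ r [MOD d]), hbWeight c N k ≤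
          C₁ * ((6 : ℝ) ^ #d.primeFactors / d) * (hbEta c N ^ 2 * N) := by
  obtain ⟨C, L₀, hC, hBT⟩ := sum_hbWeight_modEq_le
  obtain ⟨N₀, hN₀⟩ :=
    eventually_atTop.mp (eventually_regime hc (max ((2 : ℝ) ^ 16) ((|L₀| + 2) ^ 4)))
  refine ⟨128 / 3 * C, by positivity, N₀, fun N hN d hsq hodd hd1 hdle r => ?_⟩
  obtain ⟨hN6, hX₀, hη0, hη10, hsqrt, hS2, hS1, -, -⟩ := hN₀ N hN
  have hX16 : (2 : ℝ) ^ 16 ≤ hbX N := (le_max_left _ _).trans hX₀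
  have hXL : (|L₀| + 2) ^ 4 ≤ hbX N := (le_max_right _ _).trans hX₀
  have hX1 : 1 ≤ hbX N := le_trans (by norm_num) hX16
  have hX0 : 0 < hbX N := by linarith
  have hηX0 : 0 ≤ hbEta c N * hbX N := by positivity
  set s : ℝ := Real.sqrt (hbEta c N * hbX N) with hs
  have hs0 : 0 ≤ s := Real.sqrt_nonneg _
  have hs2 : s ^ 2 = hbEta c N * hbX N := Real.sq_sqrt hηX0
  have hs4 : hbX N ≤ s ^ 4 := by
    calc hbX N = Real.sqrt (hbX N) ^ 2 := (Real.sq_sqrt hX0.le).symm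
      _ ≤ (hbEta c N * hbX N) ^ 2 := pow_le_pow_left₀ (Real.sqrt_nonneg _) hsqrt 2
      _ = s ^ 4 := by rw [← hs2]; ring
  have hsL : |L₀| + 2 ≤ s :=
    (pow_le_pow_iff_left₀ (by positivity) hs0 (by norm_num : (4 : ℕ) ≠ 0)).mp (hXL.trans hs4)
  have hs_two : 2 ≤ s := le_trans (by linarith [abs_nonneg L₀]) hsL
  have hdR : (0 : ℝ) < d := by exact_mod_cast hd1
  have hd0 : 0 < d := hd1
  have hRHS : 0 ≤ 128 / 3 * C * ((6 : ℝ) ^ #d.primeFactors / d) * (hbEta c N ^ 2 * N) := by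
    positivity
  by_cases hcop : Nat.Coprime r d
  swap
  · -- classes not coprime to `d` are empty: `d ≤ √(ηX) ≤ ηX ≤ X ≤ X³ = N/6`
    have hdN : (d : ℝ) ≤ (N : ℝ) / 6 := by
      have h1 : s ≤ s ^ 2 := by nlinarith
      have h2 : hbEta c N * hbX N ≤ hbX N := by nlinarith
      have h3 : hbX N ≤ hbX N ^ 3 := by
        have h := mul_nonneg (mul_nonneg hX0.le (sub_nonneg.mpr hX1))
          (by linarith : (0 : ℝ) ≤ hbX N + 1)
        nlinarith [h]
      rw [← hbX_pow_three]
      linarith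
    rw [sum_hbWeight_modEq_eq_zero_of_not_coprime c hd0 hcop hdN]
    exact hRHS
  -- the threshold: `S/d ≥ S/s ≥ s − 1 ≥ max(L₀, s/2)`
  have hSd : s - 1 ≤ (hbSide c N : ℝ) / d := by
    have hS0 : (0 : ℝ) ≤ hbSide c N := Nat.cast_nonneg _
    have hspos : 0 < s := by linarith
    have h1 : (hbSide c N : ℝ) / s ≤ (hbSide c N : ℝ) / d :=
      div_le_div_of_nonneg_left hS0 hdR hdle
    have h2 : s - 1 ≤ (hbSide c N : ℝ) / s := by
      rw [le_div_iff₀ hspos]; nlinarith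
    linarith
  have hL₀ : L₀ ≤ (hbSide c N : ℝ) / d := by linarith [le_abs_self L₀]
  have hq2 : s / 2 ≤ (hbSide c N : ℝ) / d := by linarith
  have hBT' := hBT c N d r hd0 hcop hL₀
  -- the logarithms: `log(S/d) ≥ log(s/2) ≥ (1/4) log X − log 2 ≥ (3/16) log X`, `log N ≤ 4 log X`
  have hlogX : 0 < Real.log (hbX N) := Real.log_pos (by linarith)
  have hlogs : Real.log (hbX N) / 4 ≤ Real.log s := by
    have h := Real.log_le_log hX0 hs4
    rw [Real.log_pow] at h; push_cast at h; linarith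
  have hlog2 : Real.log 2 ≤ Real.log (hbX N) / 16 := by
    have h := Real.log_le_log (by norm_num) hX16
    rw [Real.log_pow] at h; push_cast at h; linarith
  have hlogq : 3 / 16 * Real.log (hbX N) ≤ Real.log ((hbSide c N : ℝ) / d) := by
    have h := Real.log_le_log (by linarith) hq2
    rw [Real.log_div (by linarith) two_ne_zero] at h
    linarith
  have hlogq0 : 0 < Real.log ((hbSide c N : ℝ) / d) := by
    have : 0 < 3 / 16 * Real.log (hbX N) := by positivity
    linarith
  have hℓN : Real.log N ≤ 32 * Real.log ((hbSide c N : ℝ) / d) := by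
    have := log_le_four_mul_log_hbX (N := N) (le_trans (by norm_num) hX16)
    linarith
  -- the local counts: `ν_d(r) cw(d) ≤ 6^{ω(d)} d`
  have hcw0 : 0 ≤ coprimeClassWeight d := zero_le_one.trans (one_le_coprimeClassWeight d)
  have hνcw : (cubicClassCount d r : ℝ) * coprimeClassWeight d ≤ (6 : ℝ) ^ #d.primeFactors * d := by
    have hν := cubicClassCount_prod_primes_le (t := d.primeFactors)
      (fun p hp => Nat.prime_of_mem_primeFactors hp) r
    rw [Nat.prod_primeFactors_of_squarefree hsq] at hν
    have hν' : (cubicClassCount d r : ℝ) ≤ (3 : ℝ) ^ #d.primeFactors * d := by exact_mod_cast hν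
    have hcw := coprimeClassWeight_le_two_pow d
    calc (cubicClassCount d r : ℝ) * coprimeClassWeight d
        ≤ ((3 : ℝ) ^ #d.primeFactors * d) * (2 : ℝ) ^ #d.primeFactors :=
          mul_le_mul hν' hcw hcw0 (by positivity)
      _ = (6 : ℝ) ^ #d.primeFactors * d := by
          rw [show (6 : ℝ) = 3 * 2 by norm_num, mul_pow]; ring
  -- assemble
  have hA := rpow_third_le_two_mul_hbX N
  have hfin := classSup_arith hC.le hA hX0.le (Nat.cast_nonneg _) hcw0
    (by positivity) hνcw hdR (Nat.cast_nonneg _) hS2 hlogq0 (Real.log_natCast_nonneg N) hℓN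
  rw [← cast_eq_six_mul_hbX_pow N] at hfin
  exact hBT'.trans hfin

/-! ### (B) the Euler sum `∑_d g(d) 6^{ω(d)}/d` -/

/-- **(B) the weighted Euler sum converges**: for every `N`,
`∑_{d ≤ N odd squarefree} g(d) 6^{ω(d)}/d ≤ exp(∑_n 18/n²)` (`g(d)6^ω/d = ∏_{p∣d} 6/((p−2)p) ≤ ∏ 18/p²`
and `∑_{d} ∏_{p∣d} 18/p² ≤ ∏_p (1 + 18/p²)`). [cite: Nathanson1996, §7.6 Lemma 7.8 (proof)] -/
theorem eulerSum_six_le (N : ℕ) :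
    ∑ d ∈ (Icc 1 N).filter (fun d : ℕ => Squarefree d ∧ Odd d),
        (∏ p ∈ d.primeFactors, (1 : ℝ) / ((p : ℝ) - 2)) * ((6 : ℝ) ^ #d.primeFactors / d) ≤
      Real.exp (∑' n : ℕ, (18 : ℝ) / (n : ℝ) ^ 2) := by
  classical
  set P : Finset ℕ := (Icc 1 N).filter Nat.Prime with hP
  have hS : ∀ d ∈ (Icc 1 N).filter (fun d : ℕ => Squarefree d ∧ Odd d),
      Squarefree d ∧ d.primeFactors ⊆ P := by
    intro d hd
    rw [mem_filter, mem_Icc] at hd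
    refine ⟨hd.2.1, fun p hp => ?_⟩
    have hpp := Nat.prime_of_mem_primeFactors hp
    rw [hP, mem_filter, mem_Icc]
    exact ⟨⟨hpp.one_lt.le, (Nat.le_of_mem_primeFactors hp).trans hd.1.2⟩, hpp⟩
  have hg : ∀ n : ℕ, 0 ≤ (18 : ℝ) / (n : ℝ) ^ 2 := fun n => by positivity
  have hsum : Summable (fun n : ℕ => (18 : ℝ) / (n : ℝ) ^ 2) := by
    refine ((Real.summable_one_div_nat_pow.mpr one_lt_two).mul_left 18).congr fun n => ?_
    ring
  calc ∑ d ∈ (Icc 1 N).filter (fun d : ℕ => Squarefree d ∧ Odd d),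
        (∏ p ∈ d.primeFactors, (1 : ℝ) / ((p : ℝ) - 2)) * ((6 : ℝ) ^ #d.primeFactors / d)
      = ∑ d ∈ (Icc 1 N).filter (fun d : ℕ => Squarefree d ∧ Odd d),
          ∏ p ∈ d.primeFactors, (6 : ℝ) / (((p : ℝ) - 2) * p) :=
        sum_congr rfl fun d hd => singWeight_mul_pow_div (hS d hd).1 6
    _ ≤ ∑ d ∈ (Icc 1 N).filter (fun d : ℕ => Squarefree d ∧ Odd d),
          ∏ p ∈ d.primeFactors, (18 : ℝ) / (p : ℝ) ^ 2 := by
        refine sum_le_sum fun d hd => prod_le_prod (fun p hp => ?_) fun p hp => ?_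
        · have h3 : (3 : ℝ) ≤ p := by
            exact_mod_cast three_le_of_mem_primeFactors_of_odd (mem_filter.mp hd).2.2 hp
          exact div_nonneg (by norm_num) (mul_nonneg (by linarith) (by linarith))
        · have h3 : (3 : ℝ) ≤ p := by
            exact_mod_cast three_le_of_mem_primeFactors_of_odd (mem_filter.mp hd).2.2 hp
          rw [div_le_div_iff₀ (mul_pos (by linarith) (by linarith)) (by positivity)]
          nlinarith
    _ ≤ ∏ p ∈ P, (1 + (18 : ℝ) / (p : ℝ) ^ 2) :=
        PintzRuzsa2003.sum_prod_primeFactors_le_prod_one_add _ (fun p _ => hg p) hS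
    _ ≤ Real.exp (∑' n : ℕ, (18 : ℝ) / (n : ℝ) ^ 2) := prod_one_add_le_exp_tsum P hg hsum

/-! ### (C) composition -/

/-- **`SmallModuliCorrelation` holds** (route `RomanoffHeathBrown`, crux stmt-Parity-20272): for every
`c > 0` there are `C, N₀` with `∑_{d ≤ √(ηX), d odd sqf} g(d) ∑_{r<d} U_d(r)² ≤ C · η²N · U` for
`N ≥ N₀`.  Composition of (A) `classSum_le_small`, (B) `eulerSum_six_le` and the ℓ²-to-sup step
`classEnergy_le`. -/
theorem romanoffHeathBrown_smallModuliCorrelation_proof :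
    Summit.Parity.GeneralizedHardyLittlewood.Theses.RomanoffHeathBrown.SmallModuliCorrelation := by
  intro c hc
  obtain ⟨C₁, hC₁, N₀, hA⟩ := classSum_le_small hc
  refine ⟨C₁ * Real.exp (∑' n : ℕ, (18 : ℝ) / (n : ℝ) ^ 2), N₀, fun N hN => ?_⟩
  set U : ℝ := ∑ k ∈ Icc 1 N, hbWeight c N k with hU
  have hU0 : 0 ≤ U := sum_nonneg fun k _ => hbWeight_nonneg c N k
  have hη2N : 0 ≤ hbEta c N ^ 2 * N := by positivity
  set F := (Icc 1 N).filter (fun d : ℕ => Squarefree d ∧ Odd d ∧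
    (d : ℝ) ≤ Real.sqrt (hbEta c N * hbX N)) with hF
  have hterm : ∀ d ∈ F,
      (∏ p ∈ d.primeFactors, (1 : ℝ) / ((p : ℝ) - 2)) *
          ∑ r ∈ range d, (∑ k ∈ (Icc 1 N).filter (fun k : ℕ => k ≡ r [MOD d]), hbWeight c N k) ^ 2 ≤
        (∏ p ∈ d.primeFactors, (1 : ℝ) / ((p : ℝ) - 2)) *
          (C₁ * ((6 : ℝ) ^ #d.primeFactors / d) * (hbEta c N ^ 2 * N) * U) := by
    intro d hd
    rw [hF, mem_filter, mem_Icc] at hd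
    obtain ⟨⟨hd1, -⟩, hsq, hodd, hdle⟩ := hd
    refine mul_le_mul_of_nonneg_left ?_ (prod_primeFactors_inv_sub_two_nonneg hodd)
    exact classEnergy_le c N hd1 fun r _ => hA N hN d hsq hodd hd1 hdle r
  have hsub : F ⊆ (Icc 1 N).filter (fun d : ℕ => Squarefree d ∧ Odd d) := by
    intro d hd
    rw [hF, mem_filter] at hd
    exact mem_filter.mpr ⟨hd.1, hd.2.1, hd.2.2.1⟩
  calc ∑ d ∈ F, (∏ p ∈ d.primeFactors, (1 : ℝ) / ((p : ℝ) - 2)) *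
          ∑ r ∈ range d, (∑ k ∈ (Icc 1 N).filter (fun k : ℕ => k ≡ r [MOD d]), hbWeight c N k) ^ 2
      ≤ ∑ d ∈ F, (∏ p ∈ d.primeFactors, (1 : ℝ) / ((p : ℝ) - 2)) *
          (C₁ * ((6 : ℝ) ^ #d.primeFactors / d) * (hbEta c N ^ 2 * N) * U) := sum_le_sum hterm
    _ = C₁ * (hbEta c N ^ 2 * N) * U * ∑ d ∈ F, (∏ p ∈ d.primeFactors, (1 : ℝ) / ((p : ℝ) - 2)) *
          ((6 : ℝ) ^ #d.primeFactors / d) := by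
        rw [mul_sum]
        exact sum_congr rfl fun d _ => by ring
    _ ≤ C₁ * (hbEta c N ^ 2 * N) * U *
          ∑ d ∈ (Icc 1 N).filter (fun d : ℕ => Squarefree d ∧ Odd d),
            (∏ p ∈ d.primeFactors, (1 : ℝ) / ((p : ℝ) - 2)) * ((6 : ℝ) ^ #d.primeFactors / d) := by
        refine mul_le_mul_of_nonneg_left ?_ (by positivity)
        refine sum_le_sum_of_subset_of_nonneg hsub fun d hd _ => ?_
        have hd' := (mem_filter.mp hd).2
        exact mul_nonneg (prod_primeFactors_inv_sub_two_nonneg hd'.2) (by positivity)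
    _ ≤ C₁ * (hbEta c N ^ 2 * N) * U * Real.exp (∑' n : ℕ, (18 : ℝ) / (n : ℝ) ^ 2) :=
        mul_le_mul_of_nonneg_left (eulerSum_six_le N) (by positivity)
    _ = C₁ * Real.exp (∑' n : ℕ, (18 : ℝ) / (n : ℝ) ^ 2) * (hbEta c N ^ 2 * N) * U := by ring

end Summit.Parity.GeneralizedHardyLittlewood.Theorems.RomanoffHeathBrown

end
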